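import Summits.AtomisticToContinuum.Crystallization.Theses.GappedShellCensus

/-!
# `FiveFoldRationingR` (stmt-AtomisticToContinuum-18071), negative side: a capped bond is NOT a closed
five-ring at the level of the bond's own star (pairwise band/gap constraints only)

Every proof line on the crux reads "≥ 5 common neighbours" as "(5,0): five tetrahedra about the bond"
(closed five-ring, positive curvature `ω₅`), excluding the NEGATIVE word (4,1) by the band-octahedron
dihedral window (`(4,1) ≥ 368.4° > 360°`).  At the level of the seven points involved — the bond
`(y, v)` and its five common neighbours — this exclusion is FALSE: the OPEN five-star below (bond
`0.9825`, ten spokes `1.0175`, four ring bonds `0.9825`, one ring pair OPEN at `1.2856 ≥ 63/50`) meets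
every pairwise constraint of a gapped configuration (all `21` pairs in `[0.98, 1.02] ∪ [1.26, ∞)`): four
tetrahedral dihedrals squeezed to `66.9°` leave `92.3°`, enough for a far pair (`≥ 89.5°` on the circle
of radius `0.891`), because the open pair need not span a band octahedron.  So "capped ⇒ closed
five-ring" (and with it the sign of curvature at a capped bond) must be proved from the TWELVE-NESS of the
shells of `y` and `v`, not from the ring; whether a torn-free gapped twelve-shell with such a `4T+Q` pole
exists is the seat's kit question (j022055, mode `starBBBBO`).  Margin: the star survives a uniform
slack of `0.45 %` on its three defining lengths and dies at `0.5 %` — it lives on the band edge, like the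
single-rod hoop strain.

Negative-side support for the crux (no route item is concluded positively); refuter seat
refuter-cdisprove-stmt-AtomisticToContinuum-18071-0, 2026-08-17.
-/

noncomputable section

namespace Summit.AtomisticToContinuum.Crystallization.Theorems.FiveFoldRationingR.Negative

open Literature.Geometry.DiscreteGeometry

/-- "In a configuration all of whose pairs are in the band or beyond the gap, the common-neighbour ring
of a CAPPED bond is closed: every common neighbour of a bond with `≥ 5` common neighbours is bonded to at
least two other common neighbours" — the bond-level reading of "capped ⇒ (5,0) five-ring".  A
strengthened local lemma for hypothesis analysis (Negative/ lane), not a literature fact. -/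
def CappedRingClosed : Prop :=
  ∀ (Y : Set (EuclideanSpace ℝ (Fin 3))) (a : ℝ), 0 < a →
    (∀ p ∈ Y, ∀ q ∈ Y, q ≠ p → a * (1 - 1 / 50) ≤ dist p q ∧
      (dist p q ≤ a * (1 + 1 / 50) ∨ a * (63 / 50) ≤ dist p q)) →
    ∀ y ∈ Y, ∀ v ∈ Y, v ≠ y → dist y v ≤ a * (1 + 1 / 50) →
      5 ≤ {w ∈ Y | w ≠ y ∧ w ≠ v ∧ dist y w ≤ a * (1 + 1 / 50) ∧ dist v w ≤ a * (1 + 1 / 50)}.ncard →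
      ∀ w ∈ Y, w ≠ y → w ≠ v → dist y w ≤ a * (1 + 1 / 50) → dist v w ≤ a * (1 + 1 / 50) →
        2 ≤ {w' ∈ Y | w' ≠ y ∧ w' ≠ v ∧ w' ≠ w ∧ dist y w' ≤ a * (1 + 1 / 50) ∧
          dist v w' ≤ a * (1 + 1 / 50) ∧ dist w w' ≤ a * (1 + 1 / 50)}.ncard

/-- Integer model (units of `10⁻⁴`) of the OPEN FIVE-STAR: `0 = y`, `1 = v` (bond `0.9825`),
`2 … 6 = w₁ … w₅` on the circle of radius `0.8911` at mid-height, azimuths `k · 66.914°`; ring bonds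
`w₁w₂, w₂w₃, w₃w₄, w₄w₅ = 0.9825`, open pair `w₅w₁ = 1.2856` (seat computation; not a literature fact). -/
def OpenFiveStar : Fin 7 → Fin 3 → ℤ :=
  ![![0, 0, 0], ![0, 0, 9825], ![8911, 0, 4912], ![3494, 8197, 4912], ![-6171, 6428, 4912],
    ![-8333, -3156, 4912], ![-364, -8903, 4912]]

/-- **A capped bond need not be a closed five-ring, pairwise**: in `Y = OpenFiveStar / 10⁴` (scale
`a = 1`) all `21` pairs are in `[49/50, 51/50] ∪ [63/50, ∞)`, the bond `(Y₀, Y₁)` has exactly five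
common neighbours `Y₂ … Y₆`, and `Y₂` is bonded to only ONE of the other four (`Y₃`; `Y₆` is `1.2856`
away). [folklore] -/
theorem cappedRingClosed_false : ¬ CappedRingClosed := by
  intro h
  obtain ⟨T, hinj, hsep, h01, hcommon, h02, h12, hdeg⟩ :
      ∃ T : Fin 7 → Fin 3 → ℤ,
        (∀ i j : Fin 7, sqNormInt (T i - T j) = 0 → i = j) ∧
        (∀ i j : Fin 7, j ≠ i → 96040000 ≤ sqNormInt (T i - T j) ∧
            (sqNormInt (T i - T j) ≤ 104040000 ∨ 158760000 ≤ sqNormInt (T i - T j))) ∧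
        sqNormInt (T 0 - T 1) ≤ 104040000 ∧
        (Finset.univ.filter fun w : Fin 7 =>
            w ≠ 0 ∧ w ≠ 1 ∧ sqNormInt (T 0 - T w) ≤ 104040000 ∧ sqNormInt (T 1 - T w) ≤ 104040000).card = 5 ∧
        sqNormInt (T 0 - T 2) ≤ 104040000 ∧ sqNormInt (T 1 - T 2) ≤ 104040000 ∧
        (Finset.univ.filter fun w : Fin 7 =>
            w ≠ 0 ∧ w ≠ 1 ∧ w ≠ 2 ∧ sqNormInt (T 0 - T w) ≤ 104040000 ∧
              sqNormInt (T 1 - T w) ≤ 104040000 ∧ sqNormInt (T 2 - T w) ≤ 104040000).card = 1 :=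
    ⟨OpenFiveStar, by decide, by decide, by decide, by decide, by decide, by decide, by decide⟩
  have h10 : (1 : Fin 7) ≠ 0 := by decide
  have h20 : (2 : Fin 7) ≠ 0 := by decide
  have h21 : (2 : Fin 7) ≠ 1 := by decide
  obtain ⟨pt, hpt⟩ : ∃ pt : Fin 7 → EuclideanSpace ℝ (Fin 3),
      ∀ i, pt i = (10000 : ℝ)⁻¹ • intVec (T i) := ⟨_, fun _ => rfl⟩
  have hnn : ∀ v : Fin 3 → ℤ, (0 : ℝ) ≤ (sqNormInt v : ℝ) := by
    intro v
    have h : (0 : ℤ) ≤ sqNormInt v := by unfold sqNormInt; positivity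
    exact_mod_cast h
  have hdist : ∀ i j, dist (pt i) (pt j) = (10000 : ℝ)⁻¹ * Real.sqrt (sqNormInt (T i - T j) : ℝ) := by
    intro i j
    rw [hpt, hpt, dist_eq_norm, ← smul_sub, intVec_sub, norm_smul, norm_inv,
      Real.norm_of_nonneg (by norm_num : (0 : ℝ) ≤ 10000), norm_intVec]
  have hle : ∀ (i j : Fin 7) (c : ℝ), 0 ≤ c →
      (dist (pt i) (pt j) ≤ c ↔ (sqNormInt (T i - T j) : ℝ) ≤ (10000 * c) ^ 2) := by
    intro i j c hc
    rw [hdist, inv_mul_le_iff₀ (by norm_num : (0 : ℝ) < 10000),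
      Real.sqrt_le_left (mul_nonneg (by norm_num) hc)]
  have hge : ∀ (i j : Fin 7) (c : ℝ), 0 ≤ c →
      (c ≤ dist (pt i) (pt j) ↔ (10000 * c) ^ 2 ≤ (sqNormInt (T i - T j) : ℝ)) := by
    intro i j c hc
    rw [hdist, le_inv_mul_iff₀ (by norm_num : (0 : ℝ) < 10000),
      Real.le_sqrt (mul_nonneg (by norm_num) hc) (hnn _)]
  have hle1 : ∀ i j, dist (pt i) (pt j) ≤ 1 * (1 + 1 / 50) ↔ sqNormInt (T i - T j) ≤ 104040000 := by
    intro i j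
    rw [hle i j _ (by norm_num), show ((10000 : ℝ) * (1 * (1 + 1 / 50))) ^ 2 =
      ((104040000 : ℤ) : ℝ) by norm_num, Int.cast_le]
  have hge1 : ∀ i j, 1 * (1 - 1 / 50) ≤ dist (pt i) (pt j) ↔ 96040000 ≤ sqNormInt (T i - T j) := by
    intro i j
    rw [hge i j _ (by norm_num), show ((10000 : ℝ) * (1 * (1 - 1 / 50))) ^ 2 =
      ((96040000 : ℤ) : ℝ) by norm_num, Int.cast_le]
  have hge2 : ∀ i j, 1 * (63 / 50) ≤ dist (pt i) (pt j) ↔ 158760000 ≤ sqNormInt (T i - T j) := by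
    intro i j
    rw [hge i j _ (by norm_num), show ((10000 : ℝ) * (1 * (63 / 50))) ^ 2 =
      ((158760000 : ℤ) : ℝ) by norm_num, Int.cast_le]
  have hpt_inj : ∀ i j, pt i = pt j → i = j := by
    intro i j h
    apply hinj
    rw [hpt, hpt] at h
    have h' : intVec (T i) = intVec (T j) :=
      (smul_right_injective (EuclideanSpace ℝ (Fin 3)) (by norm_num : (10000 : ℝ)⁻¹ ≠ 0)) h
    have h'' : T i = T j := intVec_injective h'
    rw [h'', sub_self]
    simp [sqNormInt]
  -- pairwise band-or-far
  have hpair : ∀ p ∈ Set.range pt, ∀ q ∈ Set.range pt, q ≠ p → 1 * (1 - 1 / 50) ≤ dist p q ∧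
      (dist p q ≤ 1 * (1 + 1 / 50) ∨ 1 * (63 / 50) ≤ dist p q) := by
    rintro p ⟨i, rfl⟩ q ⟨j, rfl⟩ hne
    have hji : j ≠ i := fun h => hne (by rw [h])
    obtain ⟨h1, h2⟩ := hsep i j hji
    refine ⟨(hge1 i j).2 h1, ?_⟩
    rcases h2 with h2 | h2
    · exact Or.inl ((hle1 i j).2 h2)
    · exact Or.inr ((hge2 i j).2 h2)
  -- the capped count
  have hcap : 5 ≤ {w ∈ Set.range pt | w ≠ pt 0 ∧ w ≠ pt 1 ∧ dist (pt 0) w ≤ 1 * (1 + 1 / 50) ∧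
      dist (pt 1) w ≤ 1 * (1 + 1 / 50)}.ncard := by
    have hset : {w ∈ Set.range pt | w ≠ pt 0 ∧ w ≠ pt 1 ∧ dist (pt 0) w ≤ 1 * (1 + 1 / 50) ∧
          dist (pt 1) w ≤ 1 * (1 + 1 / 50)} =
        ((Finset.univ.filter fun j : Fin 7 =>
            j ≠ 0 ∧ j ≠ 1 ∧ sqNormInt (T 0 - T j) ≤ 104040000 ∧
              sqNormInt (T 1 - T j) ≤ 104040000).image pt :
          Set (EuclideanSpace ℝ (Fin 3))) := by
      ext w
      simp only [Set.mem_setOf_eq, Set.mem_range, Finset.coe_image, Set.mem_image,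
        Finset.mem_coe, Finset.mem_filter, Finset.mem_univ, true_and]
      constructor
      · rintro ⟨⟨j, rfl⟩, hne0, hne1, hd0, hd1⟩
        exact ⟨j, ⟨fun h => hne0 (by rw [h]), fun h => hne1 (by rw [h]), (hle1 0 j).1 hd0,
          (hle1 1 j).1 hd1⟩, rfl⟩
      · rintro ⟨j, ⟨hj0, hj1, hd0, hd1⟩, rfl⟩
        exact ⟨⟨j, rfl⟩, fun h => hj0 (hpt_inj j 0 h), fun h => hj1 (hpt_inj j 1 h),
          (hle1 0 j).2 hd0, (hle1 1 j).2 hd1⟩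
    rw [hset, Set.ncard_coe_finset, Finset.card_image_of_injective _ (fun a b h => hpt_inj a b h),
      hcommon]
  have h4 := h (Set.range pt) 1 one_pos hpair (pt 0) ⟨0, rfl⟩ (pt 1) ⟨1, rfl⟩
    (fun h => h10 (hpt_inj 1 0 h)) ((hle1 0 1).2 h01) hcap (pt 2) ⟨2, rfl⟩
    (fun h => h20 (hpt_inj 2 0 h)) (fun h => h21 (hpt_inj 2 1 h)) ((hle1 0 2).2 h02) ((hle1 1 2).2 h12)
  have hset : {w' ∈ Set.range pt | w' ≠ pt 0 ∧ w' ≠ pt 1 ∧ w' ≠ pt 2 ∧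
        dist (pt 0) w' ≤ 1 * (1 + 1 / 50) ∧ dist (pt 1) w' ≤ 1 * (1 + 1 / 50) ∧
          dist (pt 2) w' ≤ 1 * (1 + 1 / 50)} =
      ((Finset.univ.filter fun j : Fin 7 =>
          j ≠ 0 ∧ j ≠ 1 ∧ j ≠ 2 ∧ sqNormInt (T 0 - T j) ≤ 104040000 ∧
            sqNormInt (T 1 - T j) ≤ 104040000 ∧ sqNormInt (T 2 - T j) ≤ 104040000).image pt :
        Set (EuclideanSpace ℝ (Fin 3))) := by
    ext w
    simp only [Set.mem_setOf_eq, Set.mem_range, Finset.coe_image, Set.mem_image,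
      Finset.mem_coe, Finset.mem_filter, Finset.mem_univ, true_and]
    constructor
    · rintro ⟨⟨j, rfl⟩, hne0, hne1, hne2, hd0, hd1, hd2⟩
      exact ⟨j, ⟨fun h => hne0 (by rw [h]), fun h => hne1 (by rw [h]), fun h => hne2 (by rw [h]),
        (hle1 0 j).1 hd0, (hle1 1 j).1 hd1, (hle1 2 j).1 hd2⟩, rfl⟩
    · rintro ⟨j, ⟨hj0, hj1, hj2, hd0, hd1, hd2⟩, rfl⟩
      exact ⟨⟨j, rfl⟩, fun h => hj0 (hpt_inj j 0 h), fun h => hj1 (hpt_inj j 1 h),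
        fun h => hj2 (hpt_inj j 2 h), (hle1 0 j).2 hd0, (hle1 1 j).2 hd1, (hle1 2 j).2 hd2⟩
  rw [hset, Set.ncard_coe_finset, Finset.card_image_of_injective _ (fun a b h => hpt_inj a b h),
    hdeg] at h4
  omega

end Summit.AtomisticToContinuum.Crystallization.Theorems.FiveFoldRationingR.Negative

end
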